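import Summits.QuantumFields.BalabanUV.Beta.FP.DressedEntryWardInvariance
import Literature.MathematicalPhysics.QuantumFieldTheory.Balaban1983to89.Beta.KKTFluctuationEnergy

/-!
# `BalabanUV.Beta.FP.DressedEntryWardInvarianceDual` — road «FP», binder row D1, ROUTE T, the (H5-F) option (3a): **THE DUAL BRIDGE** (an2 g85 W-11 FINDING AN2-85-1 (A),
# journal l.69234; road g63 A-1 l.69235) — `hWT` FROM THE WEIGHT DEFECT BEING ORTHOGONAL TO EVERY BOUNDED CO-CLOSED COVECTOR (NO gauge POTENTIAL) AND THE TWO PRINTED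
# TABLE LETTERS; v2's primal bridge (`DressedEntryWardInvariance` §4–§5) is the special case `hgaugeᴰ := dualGauge_of_bgrad_weight …`

WHY (an2 g85 W-11 (A); road A-1).  Road g62's `hWT_of_bgrad_of_wardTransversal` derives the END's one displayed (H5-F) junction `hWT` from the PRIMAL gauge letter
`hgauge : w c a u − w₀ c a u = ζ a (u − e_c) − ζ a u` (the defect is the backward fine gradient of a displayed potential `ζ a`) and the printed table letters
`WardTransversal (flipK T)` ((5.9)), `IndexSymmetric T` ((5.8)).  The proof only ever pairs the defect `g c a · := w c a · − w₀ c a ·` against the covectors cut out of the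
table, `(c, u) ↦ T c e (y + u − x)` (left leg) and `(e, x) ↦ T c e (y + u − x)` (right leg), and those are CO-CLOSED exactly by the two printed letters.  So the potential is
not needed: it suffices that the defect be orthogonal to bounded co-closed covectors.  ORIENTATION (FINDING FP-70 (a)): `dressedEntry`'s weight variable `u` is MINUS the fine
position (an2 PART 96 `wF … c μ p := wFRec … μ 0 c (−p)`, lit `stepCol … p := KInvStep … (−p) 0 …`); read in the POSITION variable `x = −u` the left pairing is
`lip1 Ψ G` with `Ψ c x := T c e (y − x′ − x)`, `G c x := g c a (−x)`, and lit `codiff₁ Ψ = 0` (`Σ_κ (Ψ κ (x − e_κ) − Ψ κ x) = 0`) follows VERBATIM from forward first-index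
co-closedness = `WardTransversal (flipK T)`; the right leg's `Ψ′ e x := T c e (y + u + x)` is co-closed by backward second-index co-closedness (= the same + `IndexSymmetric T`);
and v2's primal letter reads `G c · = dz (ζ a ∘ neg) c ·`, a genuine lit `AffineAveraging.dz`, so primal ⇒ dual is lit `KKTFluctuationEnergy.lip1_dz` on the nose.

WHAT ([folklore] `tsum`∕`Finset` bookkeeping BY NAME; no `def`, no `def … : Prop`, nothing cited, 0 sorry; any `d` but §5):
* §1 toolbox: `exists_bound_of_absMoment₂` (a finite family of `AbsMoment₂` tables is uniformly bounded), `tsum_prod_swap` (`Summable.tsum_prod` second-variable-outermost).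
* §2 the two dual kills **`sum_dressedSum_left_eq_zero_of_dualGauge`** (left defect orthogonal — in the position variable — to every bounded co-closed covector, table
  FORWARD-co-closed in the first index ⟹ `Σ_c dressedSum (g c) (T c) w′ y = 0`) and **`sum_dressedSum_right_eq_zero_of_dualGauge`** (right defect, table BACKWARD-co-closed
  in the second index).
* §3 **`dressedEntry_eq_of_dualGauge_of_coclosed`**, **`dressedEntry_eq_of_dualGauge_of_wardTransversal`** — `dressedEntry w T = dressedEntry w₀ T` pointwise from the DUAL gauge
  letter `hgaugeᴰ : ∀ a ψ M, (∀ c x, |ψ c x| ≤ M) → codiff₁ ψ = 0 → lip1 ψ (fun c x => w c a (−x) − w₀ c a (−x)) = 0` and the two printed table predicates (+ `AbsMoment₂` of `w, w₀, T`).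
* §4 **`dualGauge_of_bgrad`** (v2's primal letter ⟹ `hgaugeᴰ`, by `lip1_dz`) and `dualGauge_of_bgrad_weight` (the same for entry-kernel weights: v2's storey letter
  `hgauge` ⟹ §3's `hgaugeᴰ`, so v2 §4's theorem is §3's at `hgaugeᴰ := dualGauge_of_bgrad_weight …` — the primal bridge is the special case; not restated, dedup).
* §5 (d = 4, storey-indexed) **`hWT_of_dualGauge_of_wardTransversal`** — `∀ j μ ν z, dressedEntry (wF j) (𝒯 j) ((Lc:ℤ)•z) μ ν = dressedEntry (w₀ j) (𝒯 j) ((Lc:ℤ)•z) μ ν` from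
  `hgaugeᴰ j`, `hW j : WardTransversal (flipK (𝒯 j))`, `hS j : IndexSymmetric (𝒯 j)` — the END's `hWT` at `w₀ j := wStep Lc (j+1)` WITHOUT `ζ ∕ hζ`.
CENSUS EFFECT (design level; SPEC-64 §22 (2) amended when the consumer twin lands): displayed residue {`hgauge` ∀ j, `hW𝒯` j ≥ 1, `hζ`} → {`hgaugeᴰ` ∀ j, `hW𝒯` j ≥ 1};
the row's PART 98 (W-11 (B)) reduces `hgaugeᴰ` at `w := α⁻¹ • wF` to ONE column letter (K1ᶜ) of v10's (J-Λ)∕K1 family — nothing of it claimed here.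
WHAT THIS IS NOT: not `hgaugeᴰ` for any weight of the tower (DISPLAYED; by value A2-HQF0's exact gauge mode ⟹ it), not the Ward identity of any kernel (DISPLAYED for j ≥ 1; tree
theorems at the anchor, g62 `TowerFAnchorWardRecord`); nothing of Bałaban's asserted, valued or discharged; 0 estimates; 0∕4 row-D1 binders (hW, hR, D1Tel, D1Rep); NOT (C1),
NOT (T-ID), NOT D1, NEVER «G-an2-4 closed», NOT BetaPertH, NOT continuum, NOT Clay.

HONEST DEPENDENCY (page 1, mandatory): continuum YM on T⁴ ⇐ BetaPertH ∧ nine spine estimates (0/9 proved); BetaPertH ⇐ (D1) ∧ (D4) ∧ CAP+tail;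
G-an2-4 gates asym, D1 and NE2/3/4.  HONEST FRAMING (cell contract, verbatim): «discharging `BetaPertH` makes Bałaban's UV stability UNCONDITIONAL —
a real constructive-QFT result; it is NOT the continuum limit and NOT the Clay problem.»  ABSOLUTE RULE (cell charter, verbatim): «No internally-minted
statement may enter as a cited fact. Every hypothesis is either kernel-proved in this package or a verbatim quotation of a PUBLISHED theorem with page
reference. The manuscript(s) under audit are NOT citable for their own disputed steps — they are the thing under adjudication; programme-internal
(2001/route/tribunal) claims are never citable.»  Road «FP» OWNER, b2b-balaban-beta-d1-p3 gen 63, 2026-08-30.  No existing file touched.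
-/

noncomputable section

open scoped BigOperators

namespace Summit.QuantumFields.BalabanUV.Beta.FP.DressedEntryWardInvarianceDual

open Finset
open Literature.MathematicalPhysics.QuantumFieldTheory.Balaban1983to89
open Literature.MathematicalPhysics.QuantumFieldTheory.Balaban1983to89.Beta
open Literature.MathematicalPhysics.QuantumFieldTheory.Balaban1983to89.Beta.DecimatedMomentSummable (dressedSum AbsMoment₂ summable_dressed_fibre
  summable_of_absMoment₂)
open Literature.MathematicalPhysics.QuantumFieldTheory.Balaban1983to89.Beta.DressedMomentNormalisation (EKer dressedEntry)
open Literature.MathematicalPhysics.QuantumFieldTheory.Balaban1983to89.Beta.OneStepKernelFamily (flipK)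
open AffineAveraging (Form0 Form1 unitVec dz codiff₁)
open KKTFluctuationEnergy (lip0 lip1 lip1_dz)
open PolarizationSign (WardTransversal IndexSymmetric)
open Summit.QuantumFields.BalabanUV.Beta.FP.DressedEntryWeightAlgebra (dressedEntry_add_weight)
open Summit.QuantumFields.BalabanUV.Beta.FP.DressedEntryWardInvariance (absMoment₂_grad coclosed_fwd₁_of_wardTransversal_flipK
  coclosed_bwd₂_of_wardTransversal_flipK_of_indexSymmetric)

variable {d : ℕ}

/-! ## §1 Toolbox -/

/-- [folklore] a finite family of tables with absolutely summable second moments is uniformly bounded (`|T c z| ≤ Σ_c Σ'_t |T c t|`). -/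
theorem exists_bound_of_absMoment₂ (T : Fin d → (Fin d → ℤ) → ℝ) (hT : ∀ c, AbsMoment₂ (T c)) :
    ∃ M : ℝ, ∀ c z, |T c z| ≤ M := by
  refine ⟨∑ c, ∑' t, |T c t|, fun c z => ?_⟩
  have h1 : |T c z| ≤ ∑' t, |T c t| :=
    (summable_of_absMoment₂ (hT c)).abs.le_tsum z (fun t _ => abs_nonneg _)
  exact h1.trans (Finset.single_le_sum (f := fun c => ∑' t, |T c t|) (fun c _ => tsum_nonneg fun t => abs_nonneg _)
    (Finset.mem_univ c))

/-- [folklore] a summable function on `ℤ^d × ℤ^d` may be summed with the SECOND variable outermost (`Summable.tsum_prod` after `Equiv.prodComm`). -/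
theorem tsum_prod_swap {F : (Fin d → ℤ) × (Fin d → ℤ) → ℝ} (hF : Summable F) :
    ∑' p, F p = ∑' x, ∑' u, F (u, x) := by
  rw [← (Equiv.prodComm (Fin d → ℤ) (Fin d → ℤ)).tsum_eq F]
  exact hF.prod_symm.tsum_prod

/-! ## §2 The two dual kills -/

/-- [folklore] **`sum_dressedSum_left_eq_zero_of_dualGauge` — A LEFT DEFECT WEIGHT ORTHOGONAL (IN THE POSITION VARIABLE) TO EVERY BOUNDED CO-CLOSED COVECTOR IS KILLED BY A
TABLE FAMILY WITH VANISHING FORWARD FIRST-INDEX DIVERGENCE.**  For `g : Fin d → ℤ^d → ℝ` with `lip1 ψ (fun c x => g c (−x)) = 0` whenever `ψ` is bounded and `codiff₁ ψ = 0`,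
and `Σ_c (T c (z + e_c) − T c z) = 0` for every `z`: `Σ_c dressedSum (g c) (T c) w′ y = 0`.  (Each `x`-fibre of the product series is `w′ x · lip1 Ψ_x G` with
`Ψ_x c p := T c (y + (−p) − x)` bounded and co-closed.) -/
theorem sum_dressedSum_left_eq_zero_of_dualGauge {w' : (Fin d → ℤ) → ℝ} (hw' : AbsMoment₂ w') {T g : Fin d → (Fin d → ℤ) → ℝ}
    (hT : ∀ c, AbsMoment₂ (T c)) (hg : ∀ c, AbsMoment₂ (g c))
    (hdual : ∀ (ψ : Form1 d ℝ) (M : ℝ), (∀ c x, |ψ c x| ≤ M) → codiff₁ ψ = 0 → lip1 ψ (fun c x => g c (-x)) = 0)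
    (hdiv : ∀ z, ∑ c, (T c (z + Pi.single c 1) - T c z) = 0) (y : Fin d → ℤ) :
    ∑ c, dressedSum (g c) (T c) w' y = 0 := by
  have hS : ∀ c, Summable (fun p : (Fin d → ℤ) × (Fin d → ℤ) => g c p.1 * T c (y + p.1 - p.2) * w' p.2) :=
    fun c => summable_dressed_fibre (hg c) (hT c) hw' y
  obtain ⟨M, hM⟩ := exists_bound_of_absMoment₂ T hT
  unfold dressedSum
  rw [← Summable.tsum_finsetSum (fun c _ => hS c), tsum_prod_swap (summable_sum fun c _ => hS c)]
  refine (tsum_congr fun x => ?_).trans tsum_zero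
  -- the table covector of the `x`-fibre, read in the position variable `p = −u`
  have hb : ∀ c p, |(fun c p => T c (y + -p - x) : Form1 d ℝ) c p| ≤ M := fun c p => hM c _
  have hco : codiff₁ (fun c p => T c (y + -p - x) : Form1 d ℝ) = 0 := by
    funext p
    simp only [codiff₁, Pi.zero_apply]
    refine Eq.trans (Finset.sum_congr rfl fun c _ => ?_) (hdiv (y + -p - x))
    rw [show y + -(p - unitVec c) - x = y + -p - x + Pi.single c 1 from by simp only [unitVec]; abel]
  have hkill := hdual _ M hb hco
  show ∑' u, ∑ c, g c u * T c (y + u - x) * w' x = 0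
  calc ∑' u, ∑ c, g c u * T c (y + u - x) * w' x
      = w' x * ∑' u, ∑ c, g c u * T c (y + u - x) := by
        rw [← tsum_mul_left]
        refine tsum_congr fun u => ?_
        rw [Finset.mul_sum]
        exact Finset.sum_congr rfl fun c _ => by ring
    _ = w' x * lip1 (fun c p => T c (y + -p - x)) (fun c p => g c (-p)) := by
        congr 1
        unfold lip1
        rw [← (Equiv.neg (Fin d → ℤ)).tsum_eq (fun u => ∑ c, g c u * T c (y + u - x))]
        refine tsum_congr fun p => ?_
        simp only [Equiv.neg_apply]
        exact Finset.sum_congr rfl fun c _ => by ring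
    _ = 0 := by rw [hkill, mul_zero]

/-- [folklore] **`sum_dressedSum_right_eq_zero_of_dualGauge` — A RIGHT DEFECT WEIGHT ORTHOGONAL (IN THE POSITION VARIABLE) TO EVERY BOUNDED CO-CLOSED COVECTOR IS KILLED BY A
TABLE FAMILY WITH VANISHING BACKWARD SECOND-INDEX DIVERGENCE**: `Σ_e (T e (z − e_e) − T e z) = 0` for every `z` ⟹ `Σ_e dressedSum w (T e) (g e) y = 0`.  (Each `u`-fibre is
`w u · lip1 Ψ′_u G` with `Ψ′_u e p := T e (y + u + p)`.) -/
theorem sum_dressedSum_right_eq_zero_of_dualGauge {w : (Fin d → ℤ) → ℝ} (hw : AbsMoment₂ w) {T g : Fin d → (Fin d → ℤ) → ℝ}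
    (hT : ∀ e, AbsMoment₂ (T e)) (hg : ∀ e, AbsMoment₂ (g e))
    (hdual : ∀ (ψ : Form1 d ℝ) (M : ℝ), (∀ e x, |ψ e x| ≤ M) → codiff₁ ψ = 0 → lip1 ψ (fun e x => g e (-x)) = 0)
    (hdiv : ∀ z, ∑ e, (T e (z - Pi.single e 1) - T e z) = 0) (y : Fin d → ℤ) :
    ∑ e, dressedSum w (T e) (g e) y = 0 := by
  have hS : ∀ e, Summable (fun p : (Fin d → ℤ) × (Fin d → ℤ) => w p.1 * T e (y + p.1 - p.2) * g e p.2) :=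
    fun e => summable_dressed_fibre hw (hT e) (hg e) y
  obtain ⟨M, hM⟩ := exists_bound_of_absMoment₂ T hT
  unfold dressedSum
  rw [← Summable.tsum_finsetSum (fun e _ => hS e), (summable_sum fun e _ => hS e).tsum_prod]
  refine (tsum_congr fun u => ?_).trans tsum_zero
  -- the table covector of the `u`-fibre, read in the position variable `p = −x`
  have hb : ∀ e p, |(fun e p => T e (y + u + p) : Form1 d ℝ) e p| ≤ M := fun e p => hM e _
  have hco : codiff₁ (fun e p => T e (y + u + p) : Form1 d ℝ) = 0 := by
    funext p
    simp only [codiff₁, Pi.zero_apply]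
    refine Eq.trans (Finset.sum_congr rfl fun e _ => ?_) (hdiv (y + u + p))
    rw [show y + u + (p - unitVec e) = y + u + p - Pi.single e 1 from by simp only [unitVec]; abel]
  have hkill := hdual _ M hb hco
  show ∑' x, ∑ e, w u * T e (y + u - x) * g e x = 0
  calc ∑' x, ∑ e, w u * T e (y + u - x) * g e x
      = w u * ∑' x, ∑ e, T e (y + u - x) * g e x := by
        rw [← tsum_mul_left]
        refine tsum_congr fun x => ?_
        rw [Finset.mul_sum]
        exact Finset.sum_congr rfl fun e _ => by ring
    _ = w u * lip1 (fun e p => T e (y + u + p)) (fun e p => g e (-p)) := by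
        congr 1
        unfold lip1
        rw [← (Equiv.neg (Fin d → ℤ)).tsum_eq (fun x => ∑ e, T e (y + u - x) * g e x)]
        refine tsum_congr fun p => ?_
        simp only [Equiv.neg_apply, sub_neg_eq_add]
    _ = 0 := by rw [hkill, mul_zero]

/-! ## §3 The dual bridge: `dressedEntry w T = dressedEntry w₀ T` from `hgaugeᴰ` and the two table letters -/

/-- [folklore] **`dressedEntry_eq_of_dualGauge_of_coclosed` — WARD INVARIANCE OF THE DRESSED KERNEL, DUAL GAUGE LETTER.**  If, for every coarse source `a`, the weight defect
`x ↦ w c a (−x) − w₀ c a (−x)` (read in the fine position variable) is orthogonal to every bounded co-closed covector, and the table `T` is FORWARD-co-closed in its first index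
and BACKWARD-co-closed in its second, then `dressedEntry w T y a b = dressedEntry w₀ T y a b`.  (Four-term expansion at `w = w₀ + (w − w₀)`; the three defect-carrying sums are
§2's two kills.) -/
theorem dressedEntry_eq_of_dualGauge_of_coclosed (w w₀ T : EKer d)
    (hw : ∀ κ l, AbsMoment₂ (w κ l)) (h₀ : ∀ κ l, AbsMoment₂ (w₀ κ l)) (hT : ∀ c e, AbsMoment₂ (T c e))
    (hdual : ∀ (a : Fin d) (ψ : Form1 d ℝ) (M : ℝ), (∀ c x, |ψ c x| ≤ M) → codiff₁ ψ = 0 →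
      lip1 ψ (fun c x => w c a (-x) - w₀ c a (-x)) = 0)
    (hdiv₁ : ∀ (e : Fin d) (z : Fin d → ℤ), ∑ c, (T c e (z + Pi.single c 1) - T c e z) = 0)
    (hdiv₂ : ∀ (c : Fin d) (z : Fin d → ℤ), ∑ e, (T c e (z - Pi.single e 1) - T c e z) = 0)
    (y : Fin d → ℤ) (a b : Fin d) :
    dressedEntry w T y a b = dressedEntry w₀ T y a b := by
  -- the defect `g := w − w₀` and its letters
  set g : EKer d := fun κ l u => w κ l u - w₀ κ l u with hg_def
  have hg : ∀ κ l, AbsMoment₂ (g κ l) := fun κ l => absMoment₂_grad hw h₀ κ l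
  have hgD : ∀ (l : Fin d) (ψ : Form1 d ℝ) (M : ℝ), (∀ c x, |ψ c x| ≤ M) → codiff₁ ψ = 0 →
      lip1 ψ (fun c x => g c l (-x)) = 0 := fun l ψ M hb hco => hdual l ψ M hb hco
  have hw_eq : w = fun κ l u => w₀ κ l u + g κ l u := by
    funext κ l u
    simp only [hg_def]
    ring
  -- the three defect-carrying sums vanish
  have hleft : ∀ w' : Fin d → (Fin d → ℤ) → ℝ, (∀ e, AbsMoment₂ (w' e)) →
      ∑ c, ∑ e, dressedSum (g c a) (T c e) (w' e) y = 0 := by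
    intro w' hw'
    rw [Finset.sum_comm]
    refine Finset.sum_eq_zero fun e _ => ?_
    exact sum_dressedSum_left_eq_zero_of_dualGauge (hw' e) (T := fun c => T c e) (g := fun c => g c a)
      (fun c => hT c e) (fun c => hg c a) (hgD a) (fun z => hdiv₁ e z) y
  have hright : ∑ c, ∑ e, dressedSum (w₀ c a) (T c e) (g e b) y = 0 := by
    refine Finset.sum_eq_zero fun c _ => ?_
    exact sum_dressedSum_right_eq_zero_of_dualGauge (h₀ c a) (T := fun e => T c e) (g := fun e => g e b)
      (fun e => hT c e) (fun e => hg e b) (hgD b) (fun z => hdiv₂ c z) y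
  have hpure : dressedEntry g T y a b = 0 := by
    unfold dressedEntry
    exact hleft (fun e => g e b) (fun e => hg e b)
  rw [hw_eq, dressedEntry_add_weight w₀ g T h₀ hg hT y a b, hpure, hright, hleft (fun e => w₀ e b) (fun e => h₀ e b)]
  ring

/-- [folklore] **`dressedEntry_eq_of_dualGauge_of_wardTransversal` — WARD INVARIANCE OF THE DRESSED KERNEL, DUAL GAUGE LETTER, PRINTED TABLE PREDICATES.**  If, for every coarse
source `a`, the weight defect read in the fine position variable is orthogonal to every bounded co-closed covector (`hgaugeᴰ`), and `T` satisfies the printed Ward identity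
`WardTransversal (flipK T)` ((5.9), `hessKer` convention) and the printed symmetry `IndexSymmetric T` ((5.8)), then `dressedEntry w T = dressedEntry w₀ T` pointwise. -/
theorem dressedEntry_eq_of_dualGauge_of_wardTransversal (w w₀ T : EKer d)
    (hw : ∀ κ l, AbsMoment₂ (w κ l)) (h₀ : ∀ κ l, AbsMoment₂ (w₀ κ l)) (hT : ∀ c e, AbsMoment₂ (T c e))
    (hdual : ∀ (a : Fin d) (ψ : Form1 d ℝ) (M : ℝ), (∀ c x, |ψ c x| ≤ M) → codiff₁ ψ = 0 →
      lip1 ψ (fun c x => w c a (-x) - w₀ c a (-x)) = 0)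
    (hW : WardTransversal (flipK T)) (hS : IndexSymmetric T) (y : Fin d → ℤ) (a b : Fin d) :
    dressedEntry w T y a b = dressedEntry w₀ T y a b :=
  dressedEntry_eq_of_dualGauge_of_coclosed w w₀ T hw h₀ hT hdual (coclosed_fwd₁_of_wardTransversal_flipK hW)
    (coclosed_bwd₂_of_wardTransversal_flipK_of_indexSymmetric hW hS) y a b

/-! ## §4 The primal letter is the special case: a backward fine gradient of a summable potential is orthogonal to every bounded co-closed covector -/

/-- [folklore] **`dualGauge_of_bgrad` — PRIMAL ⟹ DUAL.**  If `g c u = ζ (u − e_c) − ζ u` (v2 §4's backward gauge letter in the weight variable) with `ζ` of absolutely summable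
second moment, then, read in the position variable, `(c, x) ↦ g c (−x)` is `dz (ζ ∘ neg)` and pairs to zero with every bounded co-closed covector (lit `KKTFluctuationEnergy.lip1_dz`). -/
theorem dualGauge_of_bgrad {g : Fin d → (Fin d → ℤ) → ℝ} {ζ : (Fin d → ℤ) → ℝ} (hζ : AbsMoment₂ ζ)
    (hgauge : ∀ (c : Fin d) (u : Fin d → ℤ), g c u = ζ (u - Pi.single c 1) - ζ u)
    (ψ : Form1 d ℝ) (M : ℝ) (hb : ∀ c x, |ψ c x| ≤ M) (hco : codiff₁ ψ = 0) :
    lip1 ψ (fun c x => g c (-x)) = 0 := by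
  have hξ : Summable (fun x : Fin d → ℤ => ζ (-x)) := (summable_of_absMoment₂ hζ).comp_injective neg_injective
  have hdz : (fun c x => g c (-x) : Form1 d ℝ) = dz (fun x => ζ (-x)) := by
    funext c x
    show g c (-x) = ζ (-(x + unitVec c)) - ζ (-x)
    rw [hgauge, neg_add', show (unitVec c : Fin d → ℤ) = Pi.single c 1 from rfl]
  rw [hdz, lip1_dz hb hξ, hco]
  simp only [lip0, Pi.zero_apply, zero_mul, tsum_zero]

/-- [folklore] **`dualGauge_of_bgrad_weight` — v2's storey letter `hgauge` (ONE potential `ζ a` per coarse source) ⟹ the dual letter `hgaugeᴰ`** of §3, for entry-kernel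
weights `w w₀ : EKer d`.  Hence v2's `DressedEntryWardInvariance.dressedEntry_eq_of_bgrad_of_wardTransversal w w₀ T ζ hw h₀ hζ hT hgauge hW hS` IS
`dressedEntry_eq_of_dualGauge_of_wardTransversal w w₀ T hw h₀ hT (dualGauge_of_bgrad_weight w w₀ ζ hζ hgauge) hW hS` (the primal bridge is the special case; not restated — dedup). -/
theorem dualGauge_of_bgrad_weight (w w₀ : EKer d) (ζ : Fin d → (Fin d → ℤ) → ℝ) (hζ : ∀ a, AbsMoment₂ (ζ a))
    (hgauge : ∀ (c a : Fin d) (u : Fin d → ℤ), w c a u - w₀ c a u = ζ a (u - Pi.single c 1) - ζ a u) :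
    ∀ (a : Fin d) (ψ : Form1 d ℝ) (M : ℝ), (∀ c x, |ψ c x| ≤ M) → codiff₁ ψ = 0 →
      lip1 ψ (fun c x => w c a (-x) - w₀ c a (-x)) = 0 :=
  fun a ψ M hb hco => dualGauge_of_bgrad (g := fun c u => w c a u - w₀ c a u) (hζ a) (fun c u => hgauge c a u) ψ M hb hco

/-! ## §5 The END's junction shape (d = 4), storey-indexed, dual gauge letter -/

/-- [folklore] **`hWT_of_dualGauge_of_wardTransversal` — THE (3a) JUNCTION `hWT` WITHOUT A GAUGE POTENTIAL**: for weight families `wF w₀ : ℕ → EKer 4` (the END: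
`wF j := (α j)⁻¹ • wF …` re-indexed, `w₀ j := wStep Lc (j+1)`) whose storey-`j` defect, read in the fine position variable, is orthogonal to every bounded co-closed covector
(`hgaugeᴰ`), and tables `𝒯 : ℕ → EKer 4` with `WardTransversal (flipK (𝒯 j))` (`hW`) and `IndexSymmetric (𝒯 j)` (`hS`):
`∀ j μ ν z, dressedEntry (wF j) (𝒯 j) ((Lc:ℤ)•z) μ ν = dressedEntry (w₀ j) (𝒯 j) ((Lc:ℤ)•z) μ ν`. -/
theorem hWT_of_dualGauge_of_wardTransversal (Lc : ℕ) (wF w₀ 𝒯 : ℕ → EKer 4)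
    (hwF : ∀ j κ l, AbsMoment₂ (wF j κ l)) (hw₀ : ∀ j κ l, AbsMoment₂ (w₀ j κ l)) (h𝒯 : ∀ j c e, AbsMoment₂ (𝒯 j c e))
    (hgaugeD : ∀ (j : ℕ) (a : Fin 4) (ψ : Form1 4 ℝ) (M : ℝ), (∀ c x, |ψ c x| ≤ M) → codiff₁ ψ = 0 →
      lip1 ψ (fun c x => wF j c a (-x) - w₀ j c a (-x)) = 0)
    (hW : ∀ j, WardTransversal (flipK (𝒯 j))) (hS : ∀ j, IndexSymmetric (𝒯 j)) :
    ∀ (j : ℕ) (μ ν : Fin 4) (z : Fin 4 → ℤ),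
      dressedEntry (wF j) (𝒯 j) ((Lc : ℤ) • z) μ ν = dressedEntry (w₀ j) (𝒯 j) ((Lc : ℤ) • z) μ ν :=
  fun j μ ν z => dressedEntry_eq_of_dualGauge_of_wardTransversal (wF j) (w₀ j) (𝒯 j) (hwF j) (hw₀ j) (h𝒯 j)
    (hgaugeD j) (hW j) (hS j) ((Lc : ℤ) • z) μ ν

end Summit.QuantumFields.BalabanUV.Beta.FP.DressedEntryWardInvarianceDual

end
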